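/-
Copyright (c) 2026 the pub-hodgecm-mathlib formalisation cell (harness21).  Prover seat hodgecm-mathlib-K2E3-p06 (g3): deal (D10) (T2-EX) of the dealer
K2E3-plan (g2) 2026-09-04T01:04:01Z for the (RAY¹) payer of U3b ‹Ψ-package₂¹› `sig_K2E3RankOneUnipotentScalingPackageOne` (K2E5-p12 (g2));
crux H413 = stmt-HodgeConjecture-24833; 2026-09-04.
-/
import Literature.NumberTheory.LocalFields.UnramifiedQuadraticFixedSquares        -- ★ bridge `v_lt_one_iff_valuation_lt_one`, `v_le_one_iff_mem_integer` (ValuedFieldValuativeRelBridge); ★ `residue_eq_zero_iff_valuation_lt_one` (IwahoriGL); `toPlace`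
import Literature.NumberTheory.Automorphic.UnitaryGroupInertPlaceHyperbolicBasis   -- ★ `galAdicCompletionMap_galAdicCompletionMap_of_smul_eq` (σ_w² = 1), ★ `exists_toPlace_eq_of_galAdicCompletionMap_eq` (σ_w-fixed ⇒ from `L⁺_v`)
import Literature.NumberTheory.Automorphic.AdicCompletionLocalField              -- ★ `IsNonarchimedeanLocalField (w.adicCompletion L)`: the residue field `𝓀[L_w]` is finite
import HarnessLib

/-!
# (T2-EX) At every NON-SPLIT place there is a `σ_w`-fixed scalar of `L_w` which is NOT A SQUARE in `L_w`
# (Serre, *Local Fields*, Ch. XIV §4; O'Meara §63; Neukirch ANT Ch. II (5.7))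

`Summits/HodgeConjecture/HodgeConjecture/Theorems/K2E3NonsplitPlaceNonSquareScalar.lean`; namespace
`Summit.HodgeConjecture.HodgeConjecture.Cruxes.H413.K2E3NonsplitPlaceNonSquareScalar`.  THEOREMS ONLY (no definition, no instance, no notation,
no named fact, no `sorry`); kernel lane `--supports stmt-HodgeConjecture-24833 --as helper`.  Cell `pub/hodgecm-mathlib`, Track B «K2-LIT», squad K2E3
«EllipticInputs», unit U3b: the arithmetic input **(T2-EX_v)** of the type-(2) ray (RAY¹) behind ‹Ψ-package₂¹› (K2E5-p12 (g2) FINDING 2026-09-04T00:55:58Z: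
in the Cayley model `t = c(s^m Y)`, `Y = (0 λ₀; μλ₀ 0)`, `disc χ_{c(Y′)} = (unit square) · μ`, so `χ` is IRREDUCIBLE iff `μ ∈ L⁺_v` is a non-square of `L_w`).
HONEST LABEL: HC_CM is proved only modulo the 7 printed citations (2 remaining named inputs: hLiu418 = stmt-HodgeConjecture-24832, h413 = stmt-HodgeConjecture-24833)
until rung 0 closes; this file is unconditional local algebra, count-neutral.

## The statement

For a CM field `L` with maximal totally real subfield `L⁺`, a finite place `v` of `L⁺` and a place `w ∣ v` of `L` FIXED by complex conjugation
(`c • w = w` — automatic when `w` is the only place above `v`, `Subsingleton (PlacesOver L v)`), with `σ_w = galAdicCompletionMap c hw` the induced involution of `L_w`: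

* `exists_fixed_ne_zero_not_isSquare` — **`∃ μ : L_w, σ_w μ = μ ∧ μ ≠ 0 ∧ |μ|_w ≤ 1 ∧ ¬ IsSquare μ`**;
* `exists_fixed_ne_zero_not_isSquare_of_subsingleton` — the same from `Subsingleton (PlacesOver L v)`, for every `w ∣ v`, `hw` produced;
* `exists_toPlace_ne_zero_not_isSquare` — descended: **`∃ μ₀ : L⁺_v, μ₀ ≠ 0 ∧ ¬ IsSquare (ι_w μ₀)`** (`ι_w = toPlace v w : L⁺_v →+* L_w`).

NO parity and NO ramification guard: inert, tamely ramified and wildly ramified (dyadic) `w` are covered by ONE proof.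

## The mathematics (one uniform road)

§1 is pure valuation theory: `K` a field, `v : K → ℤᵐ⁰` a valuation, `σ` a ring endomorphism with `v ∘ σ = v` and `σ ∘ σ = id`.
* (K1) `map_eq_self_or_eq_neg_of_mul_self_eq`: if `σ x = x` and `y² = x` then `(σy − y)(σy + y) = σ(y²) − y² = 0`, so `σ y = ±y`.
* (K2) `exists_fixed_lt_one_maximal`: among the `σ`-fixed `x ≠ 0` with `v x < 1` there is one, `π`, of MAXIMAL value (the values are `exp (−n)`, `n ≥ 1`;
  `Nat.find`).  [This `π` is a uniformizer of the fixed field; we never need that.]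
* (K3) `exists_fixed_ne_zero_not_isSquare_of_valuation`: if `π` is not a square, take `μ = π`.  Otherwise `π = y²`; by (K1) `σ y = ±y`, and `σ y = y` is
  absurd (`y` is fixed with `v π < v y < 1`).  So `σ y = −y` («ramified»), and then NO `σ`-fixed `c` has `v (c²π) = 1` (else `c⁻¹` is fixed with
  `v π < v c⁻¹ < 1`); consequently an ANTI-fixed `s` (`σ s = −s`) never has `v (s²) = 1` (`s∕y` is fixed).  Two cases on `v 2 ≤ 1`:
  - `v 2 < 1` (dyadic residue field): `μ = 1 + π`.  If `1 + π = s²` then `σ s = ±s` by (K1); `σ s = −s` is excluded by the previous remark; if `σ s = s`,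
    `x = s − 1` is fixed with `x (x + 2) = π`: for `v x = 1` this gives `v π = 1`, and for `v x < 1` both `x` and `x + 2` are fixed of value `< 1`, hence
    `≤ v π`, giving `v π ≤ (v π)² < v π`.
  - `v 2 = 1` (odd residue field): given an integral `z` whose residue is NOT a square (hypothesis `hk`, discharged in §2 from the FINITE residue field of odd
    characteristic, Mathlib `FiniteField.exists_nonsquare`), put `μ = (z + σz)∕2` (fixed) and `b = (z − σz)∕2 = z − μ` (anti-fixed).  `v b < 1`: otherwise
    `v b = 1` and `b∕y` is a fixed `c` with `v (c²π) = 1`.  Hence `v μ = v z = 1`, and `μ = s²` would give `v (z − s²) = v b < 1`, i.e. a square residue.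
§2 specialises to `K = L_w`, `σ = σ_w` (★ `valued_galAdicCompletionMap`, ★ `galAdicCompletionMap_galAdicCompletionMap_of_smul_eq`; seed `x₀ = t·σt` for any
`t ≠ 0` with `|t|_w < 1`), discharges `hk` (`exists_integral_residue_nonsquare_of_v_two_eq_one`), and descends `μ` to `L⁺_v` by ★ `exists_toPlace_eq_of_galAdicCompletionMap_eq`.
In print: `#(F^×∕F^{×2}) ≥ 4` for a non-archimedean local field `F ⊇ ℚ_p` while the kernel of `F^×∕F^{×2} → E^×∕E^{×2}` for a quadratic `E = F(√d)` is `{1, d}`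
[Serre1979, Ch. XIV §4; Omeara1963, §63; NeukirchANT1999, Ch. II (5.7)]; the proof above is the guard-free elementary core of that count.

## References
* [Serre1979] J.-P. Serre, *Local Fields*, GTM 67 (1979), Ch. XIV §4 (local square classes), Ch. V §3.
* [Omeara1963] O. T. O'Meara, *Introduction to Quadratic Forms* (1963), §63 (63:1a, 63:9).
* [NeukirchANT1999] J. Neukirch, *Algebraic Number Theory* (1999), Ch. II (5.7)–(5.8), Ch. V (1.5).
-/

set_option autoImplicit false

noncomputable section

open scoped WithZero
open NumberField IsDedekindDomain ValuativeRel
open Literature.NumberTheory.Automorphic Literature.NumberTheory.Automorphic.UnitaryGroup Literature.NumberTheory.GaloisRepresentations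

namespace Summit.HodgeConjecture.HodgeConjecture.Cruxes.H413.K2E3NonsplitPlaceNonSquareScalar

/-! ## §1 The abstract core: a `ℤᵐ⁰`-valued field with an isometric involution -/

section Abstract

variable {K : Type*} [Field K] (v : Valuation K ℤᵐ⁰) (σ : K →+* K)

/-- (K1) **Square roots of fixed elements are fixed or anti-fixed**: `σ x = x`, `y·y = x` ⇒ `σ y = y ∨ σ y = −y`
(`(σy − y)(σy + y) = σ(y²) − y² = 0` in a domain). [cite: Omeara1963, §63] -/
theorem map_eq_self_or_eq_neg_of_mul_self_eq {x y : K} (hx : σ x = x) (hy : y * y = x) : σ y = y ∨ σ y = -y := by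
  have h : (σ y - y) * (σ y + y) = 0 := by
    have h1 : σ y * σ y = y * y := by rw [← map_mul, hy, hx]
    linear_combination h1
  rcases mul_eq_zero.1 h with h | h
  · exact Or.inl (sub_eq_zero.1 h)
  · exact Or.inr (eq_neg_of_add_eq_zero_left h)

/-- `v (x·x) = 1 ⇒ v x = 1` in `ℤᵐ⁰`. [cite: Serre1979, Ch. XIV §4] -/
theorem valuation_eq_one_of_mul_self {x : K} (h : v (x * x) = 1) : v x = 1 := by
  have hx0 : v x ≠ 0 := by
    intro h0
    rw [map_mul, h0, mul_zero] at h
    exact zero_ne_one h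
  have hl : WithZero.log (v x) + WithZero.log (v x) = 0 := by
    rw [← WithZero.log_mul hx0 hx0, ← map_mul, h, WithZero.log_one]
  rw [← WithZero.exp_log hx0, show WithZero.log (v x) = 0 by omega, WithZero.exp_zero]

/-- (K2) **A `σ`-fixed non-zero element of MAXIMAL value `< 1`** exists as soon as some `σ`-fixed `x₀ ≠ 0` has `v x₀ < 1` (the values below `1` are
`exp (−n)`, `n ≥ 1`: minimise `n`). [cite: Serre1979, Ch. XIV §4] [cite: NeukirchANT1999, Ch. II (5.7)] -/
theorem exists_fixed_lt_one_maximal (h₀ : ∃ x₀ : K, σ x₀ = x₀ ∧ x₀ ≠ 0 ∧ v x₀ < 1) :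
    ∃ π : K, σ π = π ∧ π ≠ 0 ∧ v π < 1 ∧ ∀ x : K, σ x = x → x ≠ 0 → v x < 1 → v x ≤ v π := by
  classical
  -- every `x ≠ 0` with `v x < 1` has `v x = exp (-(n+1))` with `n = (-log (v x) - 1).toNat`
  have key : ∀ x : K, x ≠ 0 → v x < 1 →
      v x = WithZero.exp (-((((-WithZero.log (v x) - 1).toNat : ℕ) : ℤ) + 1)) := by
    intro x hx hlt
    have hv0 : v x ≠ 0 := (Valuation.ne_zero_iff v).2 hx
    have hlog : WithZero.log (v x) < 0 := by
      rw [WithZero.log_lt_iff_lt_exp hv0, WithZero.exp_zero]; exact hlt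
    conv_lhs => rw [← WithZero.exp_log hv0]
    congr 1
    omega
  obtain ⟨x₀, hσ₀, hx₀, hlt₀⟩ := h₀
  have hP : ∃ n : ℕ, ∃ x : K, σ x = x ∧ x ≠ 0 ∧ v x = WithZero.exp (-((n : ℤ) + 1)) :=
    ⟨_, x₀, hσ₀, hx₀, key x₀ hx₀ hlt₀⟩
  obtain ⟨π, hσπ, hπ0, hvπ⟩ := Nat.find_spec hP
  refine ⟨π, hσπ, hπ0, ?_, fun x hσx hx0 hlt => ?_⟩
  · rw [hvπ, ← WithZero.exp_zero, WithZero.exp_lt_exp]; omega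
  · have hmin : Nat.find hP ≤ (-WithZero.log (v x) - 1).toNat := Nat.find_min' hP ⟨x, hσx, hx0, key x hx0 hlt⟩
    rw [key x hx0 hlt, hvπ, WithZero.exp_le_exp]
    omega

/-- (K3) **THE ABSTRACT CORE.**  `v` a `ℤᵐ⁰`-valuation of a field `K`, `σ` an isometric involution (`v ∘ σ = v`, `σ² = id`), some `σ`-fixed `x₀ ≠ 0` with `v x₀ < 1`,
and — only when `v 2 = 1` — an integral `z` with `v (z − s²) ≥ 1` for all `s` (a NON-SQUARE RESIDUE).  Then some `σ`-fixed integral `μ ≠ 0` is NOT A SQUARE in `K`: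
`μ ∈ {π, 1 + π, (z + σz)∕2}` for `π` the fixed element of maximal value `< 1` (module docstring, §1). [cite: Serre1979, Ch. XIV §4] [cite: Omeara1963, §63] [cite: NeukirchANT1999, Ch. II (5.7)] -/
theorem exists_fixed_ne_zero_not_isSquare_of_valuation (hσv : ∀ x, v (σ x) = v x) (hσσ : ∀ x, σ (σ x) = x)
    (h₀ : ∃ x₀ : K, σ x₀ = x₀ ∧ x₀ ≠ 0 ∧ v x₀ < 1)
    (hk : v 2 = 1 → ∃ z : K, v z ≤ 1 ∧ ∀ s : K, ¬ v (z - s * s) < 1) :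
    ∃ μ : K, σ μ = μ ∧ μ ≠ 0 ∧ v μ ≤ 1 ∧ ¬ IsSquare μ := by
  obtain ⟨π, hσπ, hπ0, hvπ, hmax⟩ := exists_fixed_lt_one_maximal v σ h₀
  have hvπ0 : v π ≠ 0 := (Valuation.ne_zero_iff v).2 hπ0
  have hlogπ : WithZero.log (v π) < 0 := by
    rw [WithZero.log_lt_iff_lt_exp hvπ0, WithZero.exp_zero]; exact hvπ
  -- maximality in logarithmic form
  have hmax' : ∀ x : K, σ x = x → x ≠ 0 → WithZero.log (v x) < 0 → WithZero.log (v x) ≤ WithZero.log (v π) := by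
    intro x hσx hx0 hlt
    have hvx0 : v x ≠ 0 := (Valuation.ne_zero_iff v).2 hx0
    rw [WithZero.log_le_log hvx0 hvπ0]
    exact hmax x hσx hx0 (by rwa [WithZero.log_lt_iff_lt_exp hvx0, WithZero.exp_zero] at hlt)
  by_cases hsq : IsSquare π
  swap
  · exact ⟨π, hσπ, hπ0, hvπ.le, hsq⟩
  obtain ⟨y, hy⟩ := hsq
  have hy0 : y ≠ 0 := by
    rintro rfl
    exact hπ0 (by rw [hy, mul_zero])
  have hvy0 : v y ≠ 0 := (Valuation.ne_zero_iff v).2 hy0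
  have hlogy : WithZero.log (v π) = WithZero.log (v y) + WithZero.log (v y) := by
    rw [hy, map_mul, WithZero.log_mul hvy0 hvy0]
  -- the root `y` of `π` is ANTI-fixed: a fixed root would beat `π`
  have hσy : σ y = -y := by
    rcases map_eq_self_or_eq_neg_of_mul_self_eq σ hσπ hy.symm with h | h
    · exfalso
      have := hmax' y h hy0 (by omega)
      omega
    · exact h
  -- no fixed `c` with `v (c² π) = 1` (its inverse would beat `π`)
  have hnofix : ∀ c : K, σ c = c → c ≠ 0 → WithZero.log (v c) + WithZero.log (v c) + WithZero.log (v π) = 0 → False := by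
    intro c hσc hc0 hsum
    have hvc0 : v c ≠ 0 := (Valuation.ne_zero_iff v).2 hc0
    have hci : σ c⁻¹ = c⁻¹ := by rw [map_inv₀, hσc]
    have hlogci : WithZero.log (v c⁻¹) = -WithZero.log (v c) := by rw [map_inv₀, WithZero.log_inv]
    have := hmax' c⁻¹ hci (inv_ne_zero hc0) (by omega)
    omega
  -- hence no ANTI-fixed `s ≠ 0` with `v (s²) = 1` (`s ∕ y` is fixed)
  have hanti : ∀ s : K, σ s = -s → s ≠ 0 → v (s * s) = 1 → False := by
    intro s hσs hs0 hv1
    have hc : σ (s / y) = s / y := by rw [map_div₀, hσs, hσy, neg_div_neg_eq]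
    have hvs0 : v s ≠ 0 := (Valuation.ne_zero_iff v).2 hs0
    have h1 : WithZero.log (v s) + WithZero.log (v s) = 0 := by
      rw [← WithZero.log_mul hvs0 hvs0, ← map_mul, hv1, WithZero.log_one]
    have h2 : WithZero.log (v (s / y)) = WithZero.log (v s) - WithZero.log (v y) := by
      rw [map_div₀, WithZero.log_div hvs0 hvy0]
    exact hnofix (s / y) hc (div_ne_zero hs0 hy0) (by rw [h2]; omega)
  -- `v 2 ≤ 1`; split on the residue characteristic
  have h2le : v 2 ≤ 1 := by
    have h := v.map_add (1 : K) 1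
    rw [map_one, max_self, one_add_one_eq_two] at h
    exact h
  rcases h2le.lt_or_eq with h2 | h2
  · -- DYADIC residue field: `μ = 1 + π`
    have hv1π : v (1 + π) = 1 := v.map_one_add_of_lt hvπ
    have hσ1π : σ (1 + π) = 1 + π := by rw [map_add, map_one, hσπ]
    refine ⟨1 + π, hσ1π, fun h => ?_, hv1π.le, ?_⟩
    · rw [h, map_zero] at hv1π
      exact zero_ne_one hv1π
    · rintro ⟨s, hs⟩
      have hs0 : s ≠ 0 := by
        rintro rfl
        rw [mul_zero] at hs
        rw [hs, map_zero] at hv1π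
        exact zero_ne_one hv1π
      rcases map_eq_self_or_eq_neg_of_mul_self_eq σ hσ1π hs.symm with hfs | has
      · -- fixed root: `x = s - 1`, `x (x + 2) = π`
        have hσx : σ (s - 1) = s - 1 := by rw [map_sub, map_one, hfs]
        have hxπ : (s - 1) * (s - 1 + 2) = π := by linear_combination -hs
        have hvs : v s = 1 := valuation_eq_one_of_mul_self v (by rw [← hs, hv1π])
        have hvx : v (s - 1) ≤ 1 := v.map_sub_le hvs.le (le_of_eq v.map_one)
        rcases hvx.lt_or_eq with hvx | hvx
        · have hx2 : v (s - 1 + 2) < 1 := lt_of_le_of_lt (v.map_add (s - 1) 2) (max_lt hvx h2)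
          by_cases hx0 : s - 1 = 0
          · exact hπ0 (by rw [← hxπ, hx0, zero_mul])
          by_cases hx20 : s - 1 + 2 = 0
          · exact hπ0 (by rw [← hxπ, hx20, mul_zero])
          have hσx2 : σ (s - 1 + 2) = s - 1 + 2 := by rw [map_add, hσx, map_ofNat]
          have hvx0 : v (s - 1) ≠ 0 := (Valuation.ne_zero_iff v).2 hx0
          have hvx20 : v (s - 1 + 2) ≠ 0 := (Valuation.ne_zero_iff v).2 hx20
          have ha := hmax' (s - 1) hσx hx0 (by rwa [WithZero.log_lt_iff_lt_exp hvx0, WithZero.exp_zero])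
          have hb := hmax' (s - 1 + 2) hσx2 hx20 (by rwa [WithZero.log_lt_iff_lt_exp hvx20, WithZero.exp_zero])
          have hc : WithZero.log (v π) = WithZero.log (v (s - 1)) + WithZero.log (v (s - 1 + 2)) := by
            rw [← hxπ, map_mul, WithZero.log_mul hvx0 hvx20]
          omega
        · have hx2 : v (s - 1 + 2) = 1 := by
            rw [v.map_add_eq_of_lt_left (by rw [hvx]; exact h2), hvx]
          have hπ1 : v π = 1 := by rw [← hxπ, map_mul, hvx, hx2, one_mul]
          exact absurd hπ1 hvπ.ne
      · -- anti-fixed root: excluded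
        exact hanti s has hs0 (by rw [← hs, hv1π])
  · -- ODD residue field: `μ = (z + σ z) / 2` for a non-square residue `z̄`
    obtain ⟨z, hz1, hz⟩ := hk h2
    have h20 : (2 : K) ≠ 0 := fun h => by
      rw [h, map_zero] at h2
      exact zero_ne_one h2
    have hσ2 : σ 2 = 2 := map_ofNat σ 2
    have hvz : v z = 1 := le_antisymm hz1 (not_lt.1 (by simpa using hz 0))
    have hσμ : σ ((z + σ z) / 2) = (z + σ z) / 2 := by
      rw [map_div₀, map_add, hσσ, hσ2]; ring
    have hσb : σ ((z - σ z) / 2) = -((z - σ z) / 2) := by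
      rw [map_div₀, map_sub, hσσ, hσ2]; ring
    have hzμ : z - (z + σ z) / 2 = (z - σ z) / 2 := by
      field_simp
      ring
    -- `v b < 1` for `b = (z − σ z)/2`
    have hvb : v ((z - σ z) / 2) < 1 := by
      by_contra hge
      rw [not_lt] at hge
      have hvb1 : v ((z - σ z) / 2) ≤ 1 := by
        rw [map_div₀, h2, div_one]
        exact v.map_sub_le hz1 (by rw [hσv]; exact hz1)
      have hb1 : v ((z - σ z) / 2) = 1 := le_antisymm hvb1 hge
      have hb0 : (z - σ z) / 2 ≠ 0 := fun h => by
        rw [h, map_zero] at hb1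
        exact zero_ne_one hb1
      have hc : σ ((z - σ z) / 2 / y) = (z - σ z) / 2 / y := by rw [map_div₀, hσb, hσy, neg_div_neg_eq]
      have hvb0 : v ((z - σ z) / 2) ≠ 0 := (Valuation.ne_zero_iff v).2 hb0
      have hlc : WithZero.log (v ((z - σ z) / 2 / y)) = WithZero.log (v ((z - σ z) / 2)) - WithZero.log (v y) := by
        rw [map_div₀, WithZero.log_div hvb0 hvy0]
      have hlb : WithZero.log (v ((z - σ z) / 2)) = 0 := by rw [hb1, WithZero.log_one]
      exact hnofix _ hc (div_ne_zero hb0 hy0) (by rw [hlc]; omega)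
    have hvμ : v ((z + σ z) / 2) = 1 := by
      have hrw : (z + σ z) / 2 = z + -((z - σ z) / 2) := by
        field_simp
        ring
      rw [hrw, v.map_add_eq_of_lt_left (by rw [Valuation.map_neg, hvz]; exact hvb), hvz]
    refine ⟨(z + σ z) / 2, hσμ, fun h => ?_, hvμ.le, ?_⟩
    · rw [h, map_zero] at hvμ
      exact zero_ne_one hvμ
    · rintro ⟨s, hs⟩
      refine hz s ?_
      rw [show z - s * s = (z - σ z) / 2 by rw [← hs]; exact hzμ]
      exact hvb

end Abstract

/-! ## §2 The completion `L_w` of a CM field at a place fixed by complex conjugation -/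

section CM

variable (L : Type) [Field L] [NumberField L] [IsCMField L] {v : HeightOneSpectrum (𝓞 ↥(maximalRealSubfield L))}
  (w : PlacesOver L v)

omit [IsCMField L] in
/-- **Residue supply** (hypothesis `hk` of §1 for `K = L_w`): if `|2|_w = 1` the residue field `𝓀[L_w]` is a FINITE field of ODD characteristic, so it has a
non-square (Mathlib `FiniteField.exists_nonsquare`); any lift `z ∈ 𝒪_w` satisfies `|z − s²|_w ≥ 1` for every `s ∈ L_w` (an `s` with `|z − s²|_w < 1` is
integral and `z̄ = s̄²`). [cite: Serre1979, Ch. XIV §4] [cite: NeukirchANT1999, Ch. II (5.7)] -/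
theorem exists_integral_residue_nonsquare_of_v_two_eq_one (h2 : Valued.v (2 : w.1.adicCompletion L) = 1) :
    ∃ z : w.1.adicCompletion L, Valued.v z ≤ 1 ∧ ∀ s : w.1.adicCompletion L, ¬ Valued.v (z - s * s) < 1 := by
  -- the residue characteristic is not `2`
  have hchar : ringChar 𝓀[w.1.adicCompletion L] ≠ 2 := by
    intro hc
    haveI : CharP 𝓀[w.1.adicCompletion L] 2 := ringChar.of_eq hc
    have h0 : ((2 : ℕ) : 𝓀[w.1.adicCompletion L]) = 0 := CharP.cast_eq_zero 𝓀[w.1.adicCompletion L] 2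
    have hres2 : IsLocalRing.residue 𝒪[w.1.adicCompletion L] 2 = 0 := by
      rw [map_ofNat]
      exact_mod_cast h0
    rw [residue_eq_zero_iff_valuation_lt_one] at hres2
    have h2' : Valued.v (2 : w.1.adicCompletion L) < 1 := by
      rw [v_lt_one_iff_valuation_lt_one]
      exact_mod_cast hres2
    rw [h2] at h2'
    exact lt_irrefl _ h2'
  obtain ⟨c, hc⟩ := FiniteField.exists_nonsquare hchar
  obtain ⟨z, rfl⟩ := IsLocalRing.residue_surjective c
  refine ⟨(z : w.1.adicCompletion L), (v_le_one_iff_mem_integer _).2 z.2, fun s hs => hc ?_⟩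
  -- `s` is integral
  have hss : Valued.v (s * s) ≤ 1 := by
    have hrw : s * s = (z : w.1.adicCompletion L) - ((z : w.1.adicCompletion L) - s * s) := by ring
    rw [hrw]
    exact Valued.v.map_sub_le ((v_le_one_iff_mem_integer _).2 z.2) hs.le
  have hs1 : Valued.v s ≤ 1 := by
    rw [← pow_le_one_iff two_ne_zero, pow_two, ← map_mul]
    exact hss
  set s' : 𝒪[w.1.adicCompletion L] := ⟨s, (v_le_one_iff_mem_integer _).1 hs1⟩ with hs'
  have hres0 : IsLocalRing.residue 𝒪[w.1.adicCompletion L] (z - s' * s') = 0 := by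
    rw [residue_eq_zero_iff_valuation_lt_one, ← v_lt_one_iff_valuation_lt_one]
    exact_mod_cast hs
  refine ⟨IsLocalRing.residue _ s', ?_⟩
  rw [map_sub, map_mul, sub_eq_zero] at hres0
  exact hres0

variable (hw : IsCMField.complexConj L • w.1 = w.1)

include hw in
/-- **(T2-EX) — A `σ_w`-FIXED NON-SQUARE SCALAR AT A NON-SPLIT PLACE.**  For `w ∣ v` fixed by complex conjugation (`c • w = w`) there is `μ ∈ L_w` with
`σ_w μ = μ`, `μ ≠ 0`, `|μ|_w ≤ 1` and `μ` NOT A SQUARE in `L_w` — at EVERY such place (inert, tame, wild: no guard).  §1 (K3) for `K = L_w`, `σ = σ_w`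
(★ `valued_galAdicCompletionMap`, ★ `galAdicCompletionMap_galAdicCompletionMap_of_smul_eq`), seeded by `t·σ_w t` and the residue supply above.
[cite: Serre1979, Ch. XIV §4] [cite: Omeara1963, §63] [cite: NeukirchANT1999, Ch. II (5.7)] -/
theorem exists_fixed_ne_zero_not_isSquare :
    ∃ μ : w.1.adicCompletion L,
      galAdicCompletionMap (L := L) (IsCMField.complexConj L) hw μ = μ ∧ μ ≠ 0 ∧ Valued.v μ ≤ 1 ∧ ¬ IsSquare μ := by
  have hc1 : IsCMField.complexConj L ≠ 1 := IsCMField.complexConj_ne_one L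
  have hσσ : ∀ x : w.1.adicCompletion L, galAdicCompletionMap (L := L) (IsCMField.complexConj L) hw
      (galAdicCompletionMap (L := L) (IsCMField.complexConj L) hw x) = x :=
    fun x => galAdicCompletionMap_galAdicCompletionMap_of_smul_eq (IsCMField.complexConj L) w hc1 hw x
  have hσv : ∀ x : w.1.adicCompletion L, Valued.v (galAdicCompletionMap (L := L) (IsCMField.complexConj L) hw x) = Valued.v x :=
    fun x => valued_galAdicCompletionMap (L := L) (IsCMField.complexConj L) hw x
  -- seed: `t · σ t` for any `t ≠ 0` with `|t| < 1`
  obtain ⟨t, ht0, ht1⟩ := Valuation.IsNontrivial.exists_lt_one (v := (Valued.v : Valuation (w.1.adicCompletion L) ℤᵐ⁰))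
  have h₀ : ∃ x₀ : w.1.adicCompletion L, galAdicCompletionMap (L := L) (IsCMField.complexConj L) hw x₀ = x₀ ∧ x₀ ≠ 0 ∧ Valued.v x₀ < 1 := by
    refine ⟨t * galAdicCompletionMap (L := L) (IsCMField.complexConj L) hw t, by rw [map_mul, hσσ, mul_comm],
      mul_ne_zero ht0 ((map_ne_zero _).2 ht0), ?_⟩
    rw [map_mul, hσv]
    exact Left.mul_lt_one_of_lt_of_le ht1 ht1.le
  exact exists_fixed_ne_zero_not_isSquare_of_valuation Valued.v (galAdicCompletionMap (L := L) (IsCMField.complexConj L) hw) hσv hσσ h₀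
    (exists_integral_residue_nonsquare_of_v_two_eq_one L w)

omit hw in
/-- **(T2-EX), `Subsingleton (PlacesOver L v)` packaging**: at a place `v` with ONE place of `L` above it, every `w ∣ v` is fixed by `c` (★ `PlacesOver.galInv`)
and carries a `σ_w`-fixed integral non-square `μ ≠ 0`. [cite: Serre1979, Ch. XIV §4] [cite: Omeara1963, §63] -/
theorem exists_fixed_ne_zero_not_isSquare_of_subsingleton (hv : Subsingleton (PlacesOver L v)) :
    ∃ (hw : IsCMField.complexConj L • w.1 = w.1) (μ : w.1.adicCompletion L),
      galAdicCompletionMap (L := L) (IsCMField.complexConj L) hw μ = μ ∧ μ ≠ 0 ∧ Valued.v μ ≤ 1 ∧ ¬ IsSquare μ := by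
  have h : (IsCMField.complexConj L)⁻¹ • w.1 = w.1 :=
    congrArg Subtype.val (Subsingleton.elim (UnitaryGroup.PlacesOver.galInv (IsCMField.complexConj L) w) w)
  have hw : IsCMField.complexConj L • w.1 = w.1 := by
    calc IsCMField.complexConj L • w.1 = IsCMField.complexConj L • ((IsCMField.complexConj L)⁻¹ • w.1) := by rw [h]
      _ = w.1 := smul_inv_smul _ _
  exact ⟨hw, exists_fixed_ne_zero_not_isSquare L w hw⟩

include hw in
/-- **(T2-EX), descended to `L⁺_v`**: there is `μ₀ ∈ L⁺_v`, `μ₀ ≠ 0`, whose image `ι_w μ₀ ∈ L_w` is NOT A SQUARE in `L_w` (a `σ_w`-fixed element of `L_w` comes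
from `L⁺_v`, ★ `exists_toPlace_eq_of_galAdicCompletionMap_eq`). [cite: Serre1979, Ch. XIV §4] [cite: Omeara1963, §63] -/
theorem exists_toPlace_ne_zero_not_isSquare :
    ∃ μ₀ : v.adicCompletion ↥(maximalRealSubfield L), μ₀ ≠ 0 ∧ ¬ IsSquare (toPlace v w μ₀) := by
  obtain ⟨μ, hσμ, hμ0, -, hns⟩ := exists_fixed_ne_zero_not_isSquare L w hw
  obtain ⟨μ₀, hμ₀⟩ := exists_toPlace_eq_of_galAdicCompletionMap_eq (IsCMField.complexConj L) w (IsCMField.complexConj_ne_one L) hw μ hσμ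
  refine ⟨μ₀, fun h0 => hμ0 ?_, by rw [hμ₀]; exact hns⟩
  rw [← hμ₀, h0, map_zero]

end CM

/-! ## §3 The consumer's binder shape (K2E5-p12 (g2) 2026-09-04T01:06:12Z: the `(w)(hw)` frame of ★ p855890 ∕ (SC₂) ∕ (α)(β), conclusion
`σ_w μ = μ ∧ μ ≠ 0 ∧ ¬ IsSquare μ` with no valuation conjunct) -/

section Consumer

variable (L : Type) [Field L] [NumberField L] [IsCMField L] {v : HeightOneSpectrum (𝓞 ↥(maximalRealSubfield L))}
  (w : PlacesOver L v) (hw : IsCMField.complexConj L • w.1 = w.1)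

include hw in
/-- **(T2-EX) in the (RAY¹) payer's binder shape** (token for token K2E5-p12 (g2) 2026-09-04T01:06:12Z): `∃ μ : L_w, σ_w μ = μ ∧ μ ≠ 0 ∧ ¬ IsSquare μ`
— `exists_fixed_ne_zero_not_isSquare` with the integrality conjunct dropped. [cite: Serre1979, Ch. XIV §4] [cite: Omeara1963, §63] -/
theorem exists_galAdicCompletionMap_eq_and_ne_zero_and_not_isSquare :
    ∃ μ : w.1.adicCompletion L, galAdicCompletionMap (L := L) (IsCMField.complexConj L) hw μ = μ ∧ μ ≠ 0 ∧ ¬ IsSquare μ := by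
  obtain ⟨μ, hσμ, hμ0, -, hns⟩ := exists_fixed_ne_zero_not_isSquare L w hw
  exact ⟨μ, hσμ, hμ0, hns⟩

/-- **(T2-EX), `Subsingleton` frame, consumer shape**: from `Subsingleton (PlacesOver L v)`, for every `w ∣ v`, `∃ hw μ, σ_w μ = μ ∧ μ ≠ 0 ∧ ¬ IsSquare μ`.
[cite: Serre1979, Ch. XIV §4] [cite: Omeara1963, §63] -/
theorem exists_galAdicCompletionMap_eq_and_ne_zero_and_not_isSquare_of_subsingleton (hv : Subsingleton (PlacesOver L v)) :
    ∃ (hw : IsCMField.complexConj L • w.1 = w.1) (μ : w.1.adicCompletion L),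
      galAdicCompletionMap (L := L) (IsCMField.complexConj L) hw μ = μ ∧ μ ≠ 0 ∧ ¬ IsSquare μ := by
  obtain ⟨hw, μ, hσμ, hμ0, -, hns⟩ := exists_fixed_ne_zero_not_isSquare_of_subsingleton L w hv
  exact ⟨hw, μ, hσμ, hμ0, hns⟩

end Consumer

end Summit.HodgeConjecture.HodgeConjecture.Cruxes.H413.K2E3NonsplitPlaceNonSquareScalar

end
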